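import Literature.Geometry.DiscreteGeometry.TwoShellIntegerModel

/-!
# `OverbindingBudget` / crux `RobustDefectLimitWindows` (stmt-AtomisticToContinuum-31280) — «RunCut»: THE AXIS FINGERPRINT of the hcp two-shell pattern

Support file (lens-4 g87, part 8; memo `g87/memo/SW-CHI.md` §9 «D1-CORE», step (L0)).  The uniaxial-core lemma of the slip-map dictionary
(S1/(D1): all hexagonal sites within `12·nn` of a rigid-run site share ONE stacking axis) rests on four FINITE facts about the tree's `√18`
integer models `hcpModelInt = hcpInt ∪ hcpSecondShellInt` and `fccModelInt = 3·(fccInt ∪ fccSecondShellInt)` (`…TwoShellIntegerModel`) of the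
two 18-point two-shell patterns:

* (a) **the eclipsed pairs are the axis**: in the hcp model the pairs at squared distance `48` (real distance `√(8/3) = 1.633`: an atom of the
  upper triple and its mirror image in the lower triple) are EXACTLY the six with difference `±(4,4,4)`; every other pair has squared distance
  `≤ 46` or `≥ 50` (`hcpModelInt_sub_eq_48_iff`, `hcpModelInt_sub_trichotomy`, `card_hcpModelInt_eclipsed_pairs`);
* (b) **no cubic two-shell has a pair at the eclipsed distance**: in the fcc model squared distances are `9k`, never in `[46, 53]`
  (`fccModelInt_sub_dichotomy`; real form `fccTwoShellPattern_dist_sq_dichotomy`: `dist² ≤ 5/2 ∨ 3 ≤ dist²`);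
* (c) **basal selection**: every hcp pattern point has axial sum `v₀ + v₁ + v₂ ∈ {0, ±6}` — six basal points (sum `0`, all first shell) and
  twelve at axial height `h = √(2/3)` (`hcpModelInt_axialSum`, `card_hcpModelInt_basal`; real form `hcpTwoShellPattern_coordSum`);
* (d) **a basal contact position sees the axis**: from a basal point exactly seven points of the pattern-with-centre are at contact distance,
  among them an eclipsed pair (`card_hcpModelInt_basal_contact_pins`, `hcpModelInt_basal_sees_eclipsed_pair`); every non-basal first-shell
  point has its eclipsed partner in the first shell (`hcpInt_nonbasal_eclipsed`).

All integer facts are `decide`d, exactly as the tree's `TwoShellPatterns` / `TwoShellIntegerModel` checks; §2 transports (a)(b)(c) to the real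
patterns through the tree's dictionary `dist_sq_intVec_div` (`dist (v/√18) (w/√18)² = sqNormInt (v − w)/18`).  USE (memo §9.2, §10).  The DEVELOPMENT
engine of (D1) is the tree's layer-rigidity cone of the sibling leaf («CompressedCut»: `…CompressedCutReading.layer_rigidity_record`, re-based inside
the `24·nn` ball of a rigid-run site, memo §10); what this file supplies is the finite core of the ATLAS-GLUING lemma and of crossing exclusion:
(a) ⇒ an isometry carrying the hcp two-shell pattern onto an aligned copy `±H` maps the axis to `±` the axis, so two stacking data that establish
one h-site have parallel layer normals (L1); (d)+(b)+(a) ⇒ in-plane propagation of the axis without a datum (L2); (c) ⇒ basal selection near a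
crossing line (L5).  (The exact-contact sibling notion — `HasHexAxis`/`IsUniaxial` with `hcpAxisVec = (1,1,1)` — lives in
`Summits/Ventures/Crystal3D/Bulk/TwinJunctionAxes`; here the axis is the eclipsed-pair vector `(4,4,4)/√18 = 2h·(1,1,1)/√3`, which is what a
toleranced chart reads off pair distances.)
[this file: 0 definitions, 14 theorems; imports `Literature.Geometry.DiscreteGeometry.TwoShellIntegerModel` only; standard axioms]
-/

namespace Summit.AtomisticToContinuum.Crystallization.Theorems.OverbindingBudgetAffineRunCutAxisFingerprint

open Literature.Geometry.DiscreteGeometry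

/-! ## §1 The integer facts (`decide`) -/

/-- (a) **The pairs at squared distance `48` are exactly the axis-parallel ones.** [this file · kind: computation] -/
theorem hcpModelInt_sub_eq_48_iff : ∀ v ∈ hcpModelInt, ∀ w ∈ hcpModelInt,
    sqNormInt (v - w) = 48 ↔ (v - w = ![4, 4, 4] ∨ v - w = ![-4, -4, -4]) := by
  decide

/-- (a′) **The gap around `48`**: every pair of the hcp model has squared distance `= 48`, `≤ 46` or `≥ 50`
(real distances `1.633`; `≤ 1.599`; `≥ 1.667`). [this file · kind: computation] -/
theorem hcpModelInt_sub_trichotomy : ∀ v ∈ hcpModelInt, ∀ w ∈ hcpModelInt,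
    sqNormInt (v - w) = 48 ∨ sqNormInt (v - w) ≤ 46 ∨ 50 ≤ sqNormInt (v - w) := by
  decide

/-- (a″) **Six eclipsed (ordered, upward) pairs**: three in the first shell, three in the second. [this file · kind: computation] -/
theorem card_hcpModelInt_eclipsed_pairs :
    ((hcpModelInt ×ˢ hcpModelInt).filter (fun p => p.1 - p.2 = ![4, 4, 4])).card = 6 := by
  decide

/-- (d′) **Every non-basal FIRST-shell point has its eclipsed partner in the first shell.** [this file · kind: computation] -/
theorem hcpInt_nonbasal_eclipsed : ∀ v ∈ hcpInt, v 0 + v 1 + v 2 ≠ 0 →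
    ∃ w ∈ hcpInt, sqNormInt (v - w) = 48 := by
  decide

/-- (b) **No pair of the fcc model at squared distance in `[46, 53]`** (they are `9k`, `k ≤ 5` or `k ≥ 6`). [this file · kind: computation] -/
theorem fccModelInt_sub_dichotomy : ∀ v ∈ fccModelInt, ∀ w ∈ fccModelInt,
    sqNormInt (v - w) ≤ 45 ∨ 54 ≤ sqNormInt (v - w) := by
  decide

/-- (c) **Basal selection**: the axial sum of every hcp model point is `0`, `6` or `−6`. [this file · kind: computation] -/
theorem hcpModelInt_axialSum : ∀ v ∈ hcpModelInt,
    v 0 + v 1 + v 2 = 0 ∨ v 0 + v 1 + v 2 = 6 ∨ v 0 + v 1 + v 2 = -6 := by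
  decide

/-- (c′) **The six basal points are first-shell points** (the hexagon). [this file · kind: computation] -/
theorem card_hcpModelInt_basal :
    (hcpModelInt.filter (fun v => v 0 + v 1 + v 2 = 0)).card = 6 ∧
      ∀ v ∈ hcpModelInt, v 0 + v 1 + v 2 = 0 → sqNormInt v = 18 := by
  decide

/-- (d) **Seven contact pins**: from a basal point `v`, exactly seven points of the pattern-with-centre are at contact distance
(the centre, two basal neighbours, two above, two below). [this file · kind: computation] -/
theorem card_hcpModelInt_basal_contact_pins : ∀ v ∈ hcpModelInt, v 0 + v 1 + v 2 = 0 →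
    ((insert 0 hcpModelInt).filter (fun w => sqNormInt (w - v) = 18)).card = 7 := by
  decide

/-- (d″) **A basal contact position sees an eclipsed pair at contact distance.** [this file · kind: computation] -/
theorem hcpModelInt_basal_sees_eclipsed_pair : ∀ v ∈ hcpModelInt, v 0 + v 1 + v 2 = 0 →
    ∃ w₁ ∈ hcpModelInt, ∃ w₂ ∈ hcpModelInt,
      sqNormInt (w₁ - v) = 18 ∧ sqNormInt (w₂ - v) = 18 ∧ w₁ - w₂ = ![4, 4, 4] := by
  decide

/-! ## §2 The real patterns (scale `1/√18`, dictionary `dist_sq_intVec_div`) -/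

/-- ★ (a) on the real pattern: **every pair of `hcpTwoShellPattern` has `dist² = 8/3`, `≤ 23/9` or `≥ 25/9`.** [this file · kind: proof] -/
theorem hcpTwoShellPattern_dist_sq_trichotomy : ∀ x ∈ hcpTwoShellPattern, ∀ y ∈ hcpTwoShellPattern,
    dist x y ^ 2 = 8 / 3 ∨ dist x y ^ 2 ≤ 23 / 9 ∨ 25 / 9 ≤ dist x y ^ 2 := by
  intro x hx y hy
  rw [hcpTwoShellPattern_eq_image] at hx hy
  obtain ⟨v, hv, rfl⟩ := Finset.mem_image.1 hx
  obtain ⟨w, hw, rfl⟩ := Finset.mem_image.1 hy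
  simp only [Nat.cast_ofNat]
  rw [dist_sq_intVec_div]
  rcases hcpModelInt_sub_trichotomy v hv w hw with h | h | h
  · left
    have h' : (sqNormInt (v - w) : ℝ) = 48 := by exact_mod_cast h
    rw [h']; norm_num
  · right; left
    have h' : (sqNormInt (v - w) : ℝ) ≤ 46 := by exact_mod_cast h
    linarith
  · right; right
    have h' : (50 : ℝ) ≤ (sqNormInt (v - w) : ℝ) := by exact_mod_cast h
    linarith

/-- ★ (a) on the real pattern, direction form: **a pair of `hcpTwoShellPattern` at `dist² = 8/3` differs by `± (4,4,4)/√18`**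
(`= ± 2h·(1,1,1)/√3`, `h = √(2/3)`). [this file · kind: proof] -/
theorem hcpTwoShellPattern_eclipsed_axis : ∀ x ∈ hcpTwoShellPattern, ∀ y ∈ hcpTwoShellPattern,
    dist x y ^ 2 = 8 / 3 →
      (x - y = (Real.sqrt 18)⁻¹ • intVec ![4, 4, 4] ∨ y - x = (Real.sqrt 18)⁻¹ • intVec ![4, 4, 4]) := by
  intro x hx y hy hd
  rw [hcpTwoShellPattern_eq_image] at hx hy
  obtain ⟨v, hv, rfl⟩ := Finset.mem_image.1 hx
  obtain ⟨w, hw, rfl⟩ := Finset.mem_image.1 hy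
  simp only [Nat.cast_ofNat] at hd ⊢
  rw [dist_sq_intVec_div] at hd
  have h48r : (sqNormInt (v - w) : ℝ) = 48 := by linarith
  have h48 : sqNormInt (v - w) = 48 := by exact_mod_cast h48r
  rcases (hcpModelInt_sub_eq_48_iff v hv w hw).1 h48 with h | h
  · left
    rw [← smul_sub, intVec_sub, h]
  · right
    have h' : w - v = ![4, 4, 4] := by
      rw [← neg_sub, h]; decide
    rw [← smul_sub, intVec_sub, h']

/-- `‖(4,4,4)/√18‖² = 8/3` (the eclipsed-pair vector has length `2h = √(8/3)`). [this file · kind: glue] -/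
theorem norm_sq_eclipsedVec : ‖(Real.sqrt 18)⁻¹ • intVec ![4, 4, 4]‖ ^ 2 = 8 / 3 := by
  rw [norm_sq_intVec_div]
  have : (sqNormInt ![4, 4, 4] : ℝ) = 48 := by exact_mod_cast (show sqNormInt ![4, 4, 4] = 48 by decide)
  rw [this]; norm_num

/-- ★ (b) on the real pattern: **every pair of `fccTwoShellPattern` has `dist² ≤ 5/2` or `≥ 3`** — never `8/3`. [this file · kind: proof] -/
theorem fccTwoShellPattern_dist_sq_dichotomy : ∀ x ∈ fccTwoShellPattern, ∀ y ∈ fccTwoShellPattern,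
    dist x y ^ 2 ≤ 5 / 2 ∨ 3 ≤ dist x y ^ 2 := by
  intro x hx y hy
  rw [fccTwoShellPattern_eq_image] at hx hy
  obtain ⟨v, hv, rfl⟩ := Finset.mem_image.1 hx
  obtain ⟨w, hw, rfl⟩ := Finset.mem_image.1 hy
  simp only [Nat.cast_ofNat]
  rw [dist_sq_intVec_div]
  rcases fccModelInt_sub_dichotomy v hv w hw with h | h
  · left
    have h' : (sqNormInt (v - w) : ℝ) ≤ 45 := by exact_mod_cast h
    linarith
  · right
    have h' : (54 : ℝ) ≤ (sqNormInt (v - w) : ℝ) := by exact_mod_cast h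
    linarith

/-- ★ (c) on the real pattern: **the coordinate sum of every point of `hcpTwoShellPattern` is `0` or has square `2`**
(axial height `|x₀ + x₁ + x₂|/√3 ∈ {0, √(2/3)}`). [this file · kind: proof] -/
theorem hcpTwoShellPattern_coordSum : ∀ x ∈ hcpTwoShellPattern,
    x 0 + x 1 + x 2 = 0 ∨ (x 0 + x 1 + x 2) ^ 2 = 2 := by
  intro x hx
  rw [hcpTwoShellPattern_eq_image] at hx
  obtain ⟨v, hv, rfl⟩ := Finset.mem_image.1 hx
  simp only [Nat.cast_ofNat, PiLp.smul_apply, intVec_apply, smul_eq_mul]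
  rw [← mul_add, ← mul_add]
  have hs : ((v 0 : ℝ) + (v 1 : ℝ) + (v 2 : ℝ)) = ((v 0 + v 1 + v 2 : ℤ) : ℝ) := by push_cast; ring
  rw [hs]
  have h18 : ((Real.sqrt 18)⁻¹) ^ 2 = 1 / 18 := by
    rw [inv_pow, Real.sq_sqrt (by norm_num)]; norm_num
  rcases hcpModelInt_axialSum v hv with h | h | h
  · left; rw [h]; simp
  · right; rw [h, mul_pow, h18]; norm_num
  · right; rw [h, mul_pow, h18]; norm_num

end Summit.AtomisticToContinuum.Crystallization.Theorems.OverbindingBudgetAffineRunCutAxisFingerprint
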